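import Summits.ABC.ABC.Theses.CuspFieldPencil
import Summits.ABC.ABC.Theorems.YuMatveevShapeRatCloses
import Literature.NumberTheory.DiophantineGeometry.PastenSubexpPlaces
import Literature.Barriers.ABC.BakerMethodBoundsThreeRoutesProofs
import Literature.Barriers.ABC.BakerMethodBoundsStewartYuProofs
import Literature.Barriers.ABC.BakerMethodBoundsStewartTijdemanProofs
import Summits.ABC.ABC.Theorems.PlacewiseSzpiroSingleTowerSzpiroBakerSinglePlace
import Summits.ABC.ABC.Theorems.CuspFieldPencilGoldenFromNFPencil
import HarnessLib

/-!
# Stub-ideation sketch — ideator k1, GEN 3 (FAMILY 1: recognise & import) — `stub_splitCuspTriple`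
# of crux `GoldenCuspShadow` (route `CuspFieldPencil`, item stmt-ABC-26026)

GEN-3 CUT of the unconditional rational place-bound line (gen-2 k1 / k2 / conj-k2 / conj-k3 converged on it):
every helper below is either a BY-NAME tree theorem (listed in the plan, axioms audited 2026-08-31:
{propext, Classical.choice, Quot.sound}) or a ≤ 1-cycle statement whose model proof in the tree is named
in its docstring.  Bodies are `sorry` (signatures only) except the ring identities and the by-name
compositions at the end; `lean check` rc 0, sorries = helper bodies.

INPUT (tree theorem): `Summit.ABC.ABC.Theorems.approximationBound_rat_holds : ∃ K ≥ 1, PastenApproximationBound K`,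
consumed K-parametrically through `Pasten.arch_bound` / `Pasten.padic_bound_a` / `Pasten.padic_bound_c`
on the hidden ℤ-triple `T_u : w² + Q = u(u − 11w)` (`Q = u² − 11uw − w²`); route W = route U at `(w, −u)`.
-/

set_option linter.dupNamespace false

noncomputable section

open Finset Real UniqueFactorizationMonoid
open Literature.NumberTheory.DiophantineGeometry
open Literature.NumberTheory.DiophantineGeometry.Dioph
open Literature.NumberTheory.DiophantineGeometry.Pasten
open Literature.Barriers.ABC

namespace Summit.ABC.ABC.Cruxes.GoldenCuspShadow.SplitCuspRatG3

/-! ### 0. Statements -/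

/-- The registered stub `stub_splitCuspTriple`, verbatim. -/
def StubSplitCuspTriple : Prop :=
  ∀ ε : ℝ, 0 < ε → ∃ κ : ℝ, ∀ u w : ℤ, IsCoprime u w → u * w * (u ^ 2 - 11 * u * w - w ^ 2) ≠ 0 →
    Real.log (max (|(u : ℝ)|) (|(w : ℝ)|)) ≤
      κ * (((UniqueFactorizationMonoid.radical (u * w * (u ^ 2 - 11 * u * w - w ^ 2))).natAbs : ℕ) : ℝ) ^ (ε : ℝ) *
        (((((UniqueFactorizationMonoid.radical u).natAbs : ℕ) : ℝ) *
            (((UniqueFactorizationMonoid.radical w).natAbs : ℕ) : ℝ)) ^ (2 / 3 : ℝ) *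
          (((UniqueFactorizationMonoid.radical (u ^ 2 - 11 * u * w - w ^ 2)).natAbs : ℕ) : ℝ) ^ (1 / 3 : ℝ))

/-- Sanity: the sketch's copy is the crux file's registered decl up to `Iff.rfl`-level unfolding of the crux
statement is NOT claimed; what is checked is that the text above is the payload signature verbatim. -/
example : StubSplitCuspTriple ↔ StubSplitCuspTriple := Iff.rfl

/-- **Route-U bound**: `log max(|u|,|w|) ≤ κ_ε · rad(uwQ)^ε · rad u`. -/
def RouteBoundU : Prop :=
  ∀ ε : ℝ, 0 < ε → ∃ κ : ℝ, ∀ u w : ℤ, IsCoprime u w → u * w * (u ^ 2 - 11 * u * w - w ^ 2) ≠ 0 →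
    Real.log (max (|(u : ℝ)|) (|(w : ℝ)|)) ≤
      κ * (((radical (u * w * (u ^ 2 - 11 * u * w - w ^ 2))).natAbs : ℕ) : ℝ) ^ ε *
        (((radical u).natAbs : ℕ) : ℝ)

/-- **Route-W bound**: the same with `rad w` (= `RouteBoundU` at `(w, −u)`). -/
def RouteBoundW : Prop :=
  ∀ ε : ℝ, 0 < ε → ∃ κ : ℝ, ∀ u w : ℤ, IsCoprime u w → u * w * (u ^ 2 - 11 * u * w - w ^ 2) ≠ 0 →
    Real.log (max (|(u : ℝ)|) (|(w : ℝ)|)) ≤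
      κ * (((radical (u * w * (u ^ 2 - 11 * u * w - w ^ 2))).natAbs : ℕ) : ℝ) ^ ε *
        (((radical w).natAbs : ℕ) : ℝ)

/-- **MinRadBound** (U ∧ W): `log max(|u|,|w|) ≤ κ_ε · rad(uwQ)^ε · min(rad u, rad w)` — implies the stub
and the crux. -/
def MinRadBound : Prop :=
  ∀ ε : ℝ, 0 < ε → ∃ κ : ℝ, ∀ u w : ℤ, IsCoprime u w → u * w * (u ^ 2 - 11 * u * w - w ^ 2) ≠ 0 →
    Real.log (max (|(u : ℝ)|) (|(w : ℝ)|)) ≤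
      κ * (((radical (u * w * (u ^ 2 - 11 * u * w - w ^ 2))).natAbs : ℕ) : ℝ) ^ ε *
        min ((((radical u).natAbs : ℕ) : ℝ)) ((((radical w).natAbs : ℕ) : ℝ))

/-! ### L0. Ring identities (done) -/

theorem pencil_identity_u (u w : ℤ) : w ^ 2 + (u ^ 2 - 11 * u * w - w ^ 2) = u * (u - 11 * w) := by ring

theorem quadForm_swap (u w : ℤ) : w ^ 2 - 11 * w * (-u) - (-u) ^ 2 = -(u ^ 2 - 11 * u * w - w ^ 2) := by
  ring

theorem prod_swap (u w : ℤ) :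
    w * (-u) * (w ^ 2 - 11 * w * (-u) - (-u) ^ 2) = u * w * (u ^ 2 - 11 * u * w - w ^ 2) := by ring

/-! ### L1. The hidden ℕ-abc-triple with ROLES (S/M, elementary; 3 sign cases)
`Q > 0`: `(a,b,c) = (w², Q, u(u−11w))` [member on top];  `Q < 0 < u(u−11w)`: `(u(u−11w), |Q|, w²)`;
`Q < 0, u(u−11w) < 0`: `(|u(u−11w)|, w², |Q|)` [member = first summand].  Coprimality:
`GoldenFromNFPencil.isCoprime_quadForm_right` + `Int.isCoprime_iff_gcd_eq_one`; sizes: `|Q| ≤ 12H²`,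
`|u(u−11w)| ≤ 12H²`; `1 < ab` fails only if `w² = Q = 1`, impossible (`u² ∓ 11u − 2 ≠ 0`).
Model: `PencilBoundLine.exists_abcTriple_of_int_sum` (TwoSixPencilPencilBoundMember.lean:98). -/
theorem cuspTriple_u {u w : ℤ} (huw : IsCoprime u w) (h0 : u * w * (u ^ 2 - 11 * u * w - w ^ 2) ≠ 0)
    (h11 : u ≠ 11 * w) :
    ∃ a b c : ℕ, IsABCTriple a b c ∧ (c : ℝ) ≤ 13 * (max (|(u : ℝ)|) (|(w : ℝ)|)) ^ 2 ∧
      w.natAbs ^ 2 ≤ c ∧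
      ((a = (u * (u - 11 * w)).natAbs ∧ b * c = w.natAbs ^ 2 * (u ^ 2 - 11 * u * w - w ^ 2).natAbs) ∨
        (c = (u * (u - 11 * w)).natAbs ∧ a * b = w.natAbs ^ 2 * (u ^ 2 - 11 * u * w - w ^ 2).natAbs ∧
          1 < a * b)) := by
  sorry

/-! ### L2. Divisor form of the `p`-adic routes (S each, ~25 lines; clone of
`Literature.Barriers.ABC.log_le_route_a₂_placeBounds` (BakerMethodBoundsKummerPlaceBoundsProofs.lean:57)
with `ν_p(d) ≤ ν_p(a)` (`Nat.factorization_le_iff_dvd`) and the sum over `d.primeFactors ⊆ a.primeFactors`;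
inputs `Pasten.padic_bound_a` / `Pasten.padic_bound_c`, `div_log_mul_add_le`, `log_eq_sum_factorization_mul_log`). -/

theorem log_le_of_dvd_a {K : ℝ} (hK : 1 ≤ K) (hP : PastenApproximationBound K) {a b c : ℕ}
    (h : IsABCTriple a b c) {d : ℕ} (hd : d ∣ a) :
    Real.log d ≤ theta K b c 0 * Real.log (max (Real.exp 1) (2 * Real.log c)) *
      (3 * ∑ p ∈ d.primeFactors, (p : ℝ)) := by
  sorry

theorem log_le_of_dvd_c {K : ℝ} (hK : 1 ≤ K) (hP : PastenApproximationBound K) {a b c : ℕ}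
    (h : IsABCTriple a b c) (h1 : 1 < a * b) {d : ℕ} (hd : d ∣ c) :
    Real.log d ≤ theta K a b 0 * Real.log (max (Real.exp 1) (2 * Real.log c)) *
      (3 * ∑ p ∈ d.primeFactors, (p : ℝ)) := by
  sorry

/-! ### L3. Route U, raw K-parametric form (M given L1–L2): for `u ≠ 11w`,
`L < log 12 + Θ · Y(13H²) · (1 + 3 Σ_{p∣u} p)` with `Θ = theta K x y 0` on a coprime splitting `x·y = w²·|Q|`
of the two members OTHER than `u(u − 11w)`.  Case `a = |u(u−11w)|`: `Pasten.arch_bound` gives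
`log c − log a < Θ·Y`, and `c ≥ w²`, `a ≤ 12H|u|`; case `c = |u(u−11w)|`: `H² ≤ c ≤ 12H|u|` when `|w| = H`.
In both cases `log|u| ≤ Θ·Y·3σ(|u|)` by L2 with `d = |u|`; `Y` is monotone in `c ≤ 13H²`. -/
theorem route_u_raw {K : ℝ} (hK : 1 ≤ K) (hP : PastenApproximationBound K) {u w : ℤ}
    (huw : IsCoprime u w) (h0 : u * w * (u ^ 2 - 11 * u * w - w ^ 2) ≠ 0) (h11 : u ≠ 11 * w) :
    ∃ x y : ℕ, x ≠ 0 ∧ y ≠ 0 ∧ x.Coprime y ∧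
      x * y = w.natAbs ^ 2 * (u ^ 2 - 11 * u * w - w ^ 2).natAbs ∧
      Real.log (max (|(u : ℝ)|) (|(w : ℝ)|)) < Real.log 12 +
        theta K x y 0 *
          Real.log (max (Real.exp 1) (2 * Real.log (13 * (max (|(u : ℝ)|) (|(w : ℝ)|)) ^ 2))) *
          (1 + 3 * ∑ p ∈ u.natAbs.primeFactors, (p : ℝ)) := by
  sorry

/-! ### L4. Radical glue (XS/S): the `rad` of `SingleTowerSzpiroLine.theta_zero_le_mul_rpow` versus the
stub's `(radical (u*w*Q)).natAbs`, and `Σ_{p∣u} p ≤ rad u` (`Literature.Barriers.ABC.sum_le_prod_of_two_le`,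
`Nat.radical_eq_prod_primeFactors`, `Int.natAbs` of a radical = radical of `natAbs` via prime factors). -/

theorem rad_sq_eq_natAbs_radical {u w : ℤ} (h0 : u * w * (u ^ 2 - 11 * u * w - w ^ 2) ≠ 0) :
    rad (w.natAbs ^ 2) (u ^ 2 - 11 * u * w - w ^ 2).natAbs u.natAbs =
      (radical (u * w * (u ^ 2 - 11 * u * w - w ^ 2))).natAbs := by
  sorry

theorem sum_primeFactors_le_radical (z : ℤ) (hz : z ≠ 0) :
    ∑ p ∈ z.natAbs.primeFactors, (p : ℝ) ≤ (((radical z).natAbs : ℕ) : ℝ) := by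
  sorry

theorem one_le_natAbs_radical (z : ℤ) (hz : z ≠ 0) : 1 ≤ (radical z).natAbs := by
  sorry

theorem natAbs_radical_le_of_dvd {z n : ℤ} (h : z ∣ n) (hn : n ≠ 0) :
    (radical z).natAbs ≤ (radical n).natAbs := by
  sorry

/-! ### L5. Endgame (S): `Y(13H²) = log max(e, 2(log 13 + 2L))`-absorption by
`Literature.Barriers.ABC.le_of_le_mul_log_max` (`y ≤ M log max(e,2y) ⇒ y ≤ 2M log(4M)`, with `y = log 13 + 2L`)
and `log(4M) ≤ C_η R^η` (`Real.log_le_rpow_div`, `m ≤ R`). -/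
theorem endgame {A η : ℝ} (hA : 1 ≤ A) (hη : 0 < η) :
    ∃ C : ℝ, 0 < C ∧ ∀ L R m : ℝ, 0 ≤ L → 1 ≤ R → 1 ≤ m → m ≤ R →
      L < Real.log 12 +
          A * R ^ η * Real.log (max (Real.exp 1) (2 * Real.log (13 * (Real.exp L) ^ 2))) * (4 * m) →
      L ≤ C * R ^ (2 * η) * m := by
  sorry

/-! ### Assembly -/

/-- L1–L5 ⇒ route-U bound for every `K ≥ 1` with `PastenApproximationBound K` (M):
`obtain ⟨C₁, hC₁, hC⟩ := SingleTowerSzpiroLine.exists_prod_mul_log_div_rpow_le (A := K) _ (η := ε/2)`;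
per `(u,w)`: degenerate `u = 11w` ⇒ `H = 11` (`κ ≥ log 11`); else `route_u_raw` ▸
`theta_zero_le_mul_rpow … (hdvd : x*y ∣ w.natAbs^2 * |Q| * |u|)` ▸ `rad_sq_eq_natAbs_radical` ▸
`1 + 3σ ≤ 4 rad u` (`sum_primeFactors_le_radical`, `one_le_natAbs_radical`) ▸ `endgame` (`H = exp L`). -/
theorem routeBoundU_of_pasten {K : ℝ} (hK : 1 ≤ K) (hP : PastenApproximationBound K) :
    RouteBoundU := by
  sorry

/-- Route W from route U at `(w, −u)` (`prod_swap`, `quadForm_swap`, `IsCoprime.neg_right`, `Int.cast_neg`,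
`abs_neg`, `max_comm`). (S) -/
theorem routeBoundW_of_routeBoundU (h : RouteBoundU) : RouteBoundW := by
  sorry

/-- `min`: take `κ := max κ_U κ_W` (both sides nonnegative). (S) -/
theorem minRadBound_of_routes (hU : RouteBoundU) (hW : RouteBoundW) : MinRadBound := by
  sorry

/-- **MinRadBound, UNCONDITIONAL** — by the tree theorem `approximationBound_rat_holds`. -/
theorem minRadBound : MinRadBound := by
  obtain ⟨K, hK, hP⟩ := Summit.ABC.ABC.Theorems.approximationBound_rat_holds
  have hU := routeBoundU_of_pasten hK hP
  exact minRadBound_of_routes hU (routeBoundW_of_routeBoundU hU)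

/-- The stub from `MinRadBound` (S, real arithmetic): `min(P,P') ≤ (P·P')^{1/2} ≤ (P·P')^{2/3}` and
`rad(Q)^{1/3} ≥ 1` (all bases `≥ 1`: `one_le_natAbs_radical`; `Real.rpow_le_rpow_of_exponent_le`). -/
theorem stubSplitCuspTriple_of_minRadBound (h : MinRadBound) : StubSplitCuspTriple := by
  sorry

/-- The crux from `MinRadBound` (S): `min(rad u, rad w) ≤ (rad u · rad w)^{1/2} ≤ rad(uwQ)^{1/2}`
(`GoldenFromNFPencil.natAbs_radical_prod`, `Real.rpow_add`, `Real.rpow_natCast`). -/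
theorem goldenCuspShadow_of_minRadBound (h : MinRadBound) :
    Summit.ABC.ABC.Theses.CuspFieldPencil.GoldenCuspShadow := by
  sorry

/-- The stub (what lands verbatim as `theorem stub_splitCuspTriple : Sig.stub_splitCuspTriple`). -/
theorem stubSplitCuspTriple : StubSplitCuspTriple :=
  stubSplitCuspTriple_of_minRadBound minRadBound

/-- The landing file's last line (closes stmt-ABC-26026 outright). -/
theorem goldenCuspShadow : Summit.ABC.ABC.Theses.CuspFieldPencil.GoldenCuspShadow :=
  goldenCuspShadow_of_minRadBound minRadBound

/-! ### Sanity instances of L1's three sign cases (kernel-checked) -/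

-- `(u,w) = (1,2)`: `Q = 1 − 22 − 4 = −25 < 0`, `u(u−11w) = −21 < 0`: `21 + 4 = 25`, member = first summand.
example : IsABCTriple 21 4 25 := by
  refine ⟨by norm_num, by norm_num, by norm_num, by decide⟩
-- `(u,w) = (12,1)`: `Q = 144 − 132 − 1 = 11 > 0`, `u(u−11w) = 12`: `1 + 11 = 12`, member on top, `1 < ab`.
example : IsABCTriple 1 11 12 ∧ 1 < 1 * 11 := by
  refine ⟨⟨by norm_num, by norm_num, by norm_num, by decide⟩, by norm_num⟩
-- `(u,w) = (13,1)`: `Q = 169 − 143 − 1 = 25 > 0`, `u(u−11w) = 26`: `1 + 25 = 26`.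
example : IsABCTriple 1 25 26 := by
  refine ⟨by norm_num, by norm_num, by norm_num, by decide⟩
-- `(u,w) = (1,−12)`… route U at `(u,w) = (2,1)`: `Q = 4 − 22 − 1 = −19`, `u(u−11w) = −18`: `18 + 1 = 19`.
example : IsABCTriple 18 1 19 := by
  refine ⟨by norm_num, by norm_num, by norm_num, by decide⟩

end Summit.ABC.ABC.Cruxes.GoldenCuspShadow.SplitCuspRatG3
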